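import Mathlib
import Summits.Ventures.PercRepro.TriangleCapBelowGen

/-!
# PercRepro — THE CAP ON THE CELL `(k, 4, 2)`: a `K₄⁻`-free graph with `4 (k − 4) − 2` edges on `k ≥ 11` vertices
with a vertex of degree `k − 4` is `4`-bipartite or at least `T = 2k − 18` below the closed form (p3, gen 45;
part 198a)

On the cell `(k, 4, 2)` the one-triangle family `T` of §10bt(e) exists (`r = a − 2`): `K_{4,k−5}` with a vertex
hung on an edge is `2k − 18` below the closed form, less than `B2 = 4 (k − 9)` for `k > 9`. The cap lemma of
part 196a (`below_cap_gen`, `r ≤ a − 3`) concluded `M = 0`; here the same count leaves `M ≤ 1`, and `M = 1` is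
exactly the one-triangle structure. With `N = N(x)`, `|N| = K = k − 4`, `M` the matching inside `N`, `R` the
three non-neighbours, `P = Σ_{u ∈ R} degIn N u`, `E = adjPairs R`:
* the degree sum is `2K + 2M + 2P + E = 2m = 8K − 4`; one end per matching edge gives `P + 3M ≤ 3K`; an edge
  `u v` inside `R` forces `P_u + P_v ≤ K + 1` and `P_w + M ≤ K`, hence `E ≥ 2K − 6 ≥ 8 > 6` — impossible; so
  `E = 0` and then `2M ≤ 2` (`four_cap_count`);
* `M = 0`: `D ⊆ K(N(x)ᶜ, N(x))`, `4`-bipartite;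
* `M = 1`: `P = 3K − 3`; every `u ∈ R` has `d(u) = P_u ≤ K − 1`, so `Σ_R d² ≤ (K − 1) P`; every `y ∈ N` has
  `d(y) = 1 + f(y) + g(y)` with `f = degIn N y ≤ 1`, `g = degIn R y ≤ 3`, and `(1 + f + g)² ≤ 1 + 3f + 5g + 2fg`;
  on the matching edge `y y'` each `u ∈ R` is adjacent to at most one end, so `2 Σ_N f g ≤ |R| · adjPairs N = 6`
  (`two_mul_sum_degIn_mul_degIn_le`, one end per matching edge weighted by a general `R`); altogether
  `Σ d² ≤ K² + (K + 12 + 5P) + (K − 1) P = 4K² + 10K`, which is the target `m k − 2 (k − 3) − (2k − 18)` exactly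
  (`four_cap_sq_arith`).
Axioms: standard.
-/

namespace PercRepro

namespace TriangleCap

namespace C047

open Finset

variable {V : Type*} [Fintype V] [DecidableEq V]

/-- **ONE END PER MATCHING EDGE, WEIGHTED BY A SET `R` OFF `x`:** for `N = N(x)` and `R` a set of vertices `≠ x`,
`2 Σ_{y ∈ N} degIn N y · degIn R y ≤ |R| · adjPairs N`: on an edge `y y'` of `N` (a matching edge), each `u ∈ R` is
adjacent to at most one of `y, y'` (`not_adj_both`), so `degIn R y + degIn R y' ≤ |R|`. -/
theorem two_mul_sum_degIn_mul_degIn_le (D : SimpleGraph V) [DecidableRel D.Adj] (hK : K4mFree D) (x : V)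
    (R : Finset V) (hR : ∀ u ∈ R, u ≠ x) :
    2 * ∑ y ∈ univ.filter (fun w => D.Adj x w), degIn D (univ.filter (fun w => D.Adj x w)) y * degIn D R y ≤
      R.card * adjPairs D (univ.filter (fun w => D.Adj x w)) := by
  obtain ⟨N, hN⟩ : ∃ N : Finset V, N = univ.filter (fun w => D.Adj x w) := ⟨_, rfl⟩
  rw [← hN]
  have hmemN : ∀ w, w ∈ N ↔ D.Adj x w := fun w => by rw [hN, mem_filter]; simp only [mem_univ, true_and]
  -- on an edge of `N`, `degIn R y + degIn R y' ≤ |R|`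
  have hpair : ∀ y ∈ N, ∀ y' ∈ N, D.Adj y y' → degIn D R y + degIn D R y' ≤ R.card := by
    intro y hy y' hy' hyy'
    unfold degIn
    have hdisj : Disjoint (R.filter (fun u => D.Adj y u)) (R.filter (fun u => D.Adj y' u)) := by
      rw [disjoint_left]
      intro u hu1 hu2
      rw [mem_filter] at hu1 hu2
      exact not_adj_both D hK hyy' (D.adj_symm ((hmemN y).mp hy)) (D.adj_symm ((hmemN y').mp hy'))
        (hR u hu1.1).symm hu1.2 hu2.2
    have h := card_union_add_card_inter (R.filter (fun u => D.Adj y u)) (R.filter (fun u => D.Adj y' u))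
    rw [disjoint_iff_inter_eq_empty.mp hdisj, card_empty, add_zero] at h
    have hsub : (R.filter (fun u => D.Adj y u)) ∪ (R.filter (fun u => D.Adj y' u)) ⊆ R :=
      union_subset (filter_subset _ _) (filter_subset _ _)
    have := card_le_card hsub
    omega
  have hL := double_sum_ite_left D N N (fun y => degIn D R y)
  have hR' := double_sum_ite_right D N N (fun y => degIn D R y)
  have h2 : (∑ y ∈ N, ∑ y' ∈ N, if D.Adj y y' then degIn D R y else 0) +
      (∑ y ∈ N, ∑ y' ∈ N, if D.Adj y y' then degIn D R y' else 0) ≤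
      ∑ y ∈ N, ∑ y' ∈ N, if D.Adj y y' then R.card else 0 := by
    rw [← sum_add_distrib]
    apply sum_le_sum
    intro y hy
    rw [← sum_add_distrib]
    apply sum_le_sum
    intro y' hy'
    by_cases h : D.Adj y y'
    · simp only [h, if_true]
      exact hpair y hy y' hy' h
    · simp [h]
  have h3 := double_sum_ite_left D N N (fun _ => R.card)
  rw [hL, hR', h3] at h2
  rw [adjPairs_eq_sum_degIn]
  have h4 : ∑ y ∈ N, degIn D N y * R.card = R.card * ∑ y ∈ N, degIn D N y := by
    rw [mul_sum]
    apply sum_congr rfl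
    intro y _
    ring
  rw [h4] at h2
  omega

/-- The count at the cap of the cell `(k, 4, 2)`: `2K + 2M + 2P + E = 2m`, `m + 2 = 4K`, `P + 3M ≤ 3K`, `E ≤ 6`,
`K ≥ 7`, and an edge inside `R` would force `P + M ≤ 2K + 1` ⇒ `E = 0` and `M ≤ 1`. -/
theorem four_cap_count (K M P E m : ℕ) (hdeg : K + (K + 2 * M + P) + (P + E) = 2 * m) (hm : m + 2 = 4 * K)
    (h2 : P + 3 * M ≤ 3 * K) (hE : E ≤ 6) (hK : 7 ≤ K) (hnoedge : 1 ≤ E → P + M ≤ 2 * K + 1) :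
    E = 0 ∧ M ≤ 1 := by
  by_cases hE1 : 1 ≤ E
  · have := hnoedge hE1
    omega
  · omega

/-- `(1 + f + g)² ≤ 1 + 3f + 5g + 2fg` for `f ≤ 1`, `g ≤ 3`. -/
theorem cap_sq_bound (f g : ℕ) (hf : f ≤ 1) (hg : g ≤ 3) :
    (1 + f + g) * (1 + f + g) ≤ 1 + 3 * f + 5 * g + 2 * (f * g) := by
  interval_cases f <;> interval_cases g <;> norm_num

omit [Fintype V] in
/-- `adjPairs R ≤ |R| (|R| − 1)`: the adjacent ordered pairs of `R` are off the diagonal. -/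
theorem adjPairs_le_card_mul_pred (D : SimpleGraph V) [DecidableRel D.Adj] (R : Finset V) :
    adjPairs D R ≤ R.card * (R.card - 1) := by
  rw [adjPairs_eq_sum_degIn]
  calc ∑ u ∈ R, degIn D R u ≤ ∑ _u ∈ R, (R.card - 1) := sum_le_sum (fun u hu => degIn_le_card_sub_one D hu)
    _ = R.card * (R.card - 1) := by rw [sum_const, smul_eq_mul]

/-- **THE ARITHMETIC OF THE CASE `M = 1`:** `K ≥ 7`, `m + 2 = 4K`, `2K + 2 + 2P = 2m` (so `P = 3K − 3`),
`S_N ≤ K + 12 + 5P`, `S_R ≤ (K − 1) P` ⇒ `K² + S_N + S_R + 2 (k − 3) + 2 (k − 9) ≤ m k` with `k = K + 4`. -/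
theorem four_cap_sq_arith (K P SN SR m : ℕ) (hK : 7 ≤ K) (hm : m + 2 = 4 * K) (hP : 2 * K + 2 + 2 * P = 2 * m)
    (hSN : SN ≤ K + 12 + 5 * P) (hSR : SR ≤ (K - 1) * P) :
    K * K + SN + SR + 2 * (K + 4 - 3) + 2 * (K + 4 - 9) ≤ m * (K + 4) := by
  obtain ⟨t, rfl⟩ : ∃ t, K = t + 7 := ⟨K - 7, by omega⟩
  have hP' : P = 3 * t + 18 := by omega
  have hm' : m = 4 * t + 26 := by omega
  subst hP' hm'
  have e1 : t + 7 + 4 - 3 = t + 8 := by omega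
  have e2 : t + 7 + 4 - 9 = t + 2 := by omega
  have e3 : t + 7 - 1 = t + 6 := by omega
  rw [e1, e2]
  rw [e3] at hSR
  nlinarith [hSN, hSR]

/-- **THE CAP ON THE CELL `(k, 4, 2)`, `k ≥ 11`:** a `K₄⁻`-free graph with `4 (k − 4) − 2` edges and a vertex `x` of
degree `k − 4` is a spanning subgraph of some `K(A, Aᶜ)` with `|A| = 4`, or `Σ_v d(v)² + 2 (k − 3) + 2 (k − 9) ≤ m k`
(the one-triangle family `T`, exact). -/
theorem four_cap (D : SimpleGraph V) [DecidableRel D.Adj] (hK : K4mFree D) (hk : 11 ≤ Fintype.card V)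
    (hm : D.edgeFinset.card + 2 = 4 * (Fintype.card V - 4)) (x : V) (hx : deg D x + 4 = Fintype.card V) :
    (∃ A : Finset V, A.card = 4 ∧ BipSub D A) ∨
      ∑ v, deg D v * deg D v + 2 * (Fintype.card V - 3) + 2 * (Fintype.card V - 9) ≤
        D.edgeFinset.card * Fintype.card V := by
  obtain ⟨N, hN⟩ : ∃ N : Finset V, N = univ.filter (fun w => D.Adj x w) := ⟨_, rfl⟩
  have hmemN : ∀ w, w ∈ N ↔ D.Adj x w := fun w => by rw [hN, mem_filter]; simp only [mem_univ, true_and]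
  have hxN : x ∉ N := fun h => D.irrefl ((hmemN x).mp h)
  have hdx : deg D x = N.card := by rw [hN]; rfl
  obtain ⟨K, hKdef⟩ : ∃ K, N.card = K := ⟨_, rfl⟩
  have hcardV : Fintype.card V = K + 4 := by omega
  obtain ⟨m, hmdef⟩ : ∃ m, D.edgeFinset.card = m := ⟨_, rfl⟩
  -- the max-degree cap: every degree is `≤ k − 4`
  have hcap : ∀ v, deg D v + 4 ≤ Fintype.card V := fun v =>
    deg_add_le_card_of_dense D hK 4 (by omega) (by omega)
      (cap_arith 4 (Fintype.card V) D.edgeFinset.card 2 (by omega) (by omega)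
        (below_cap_arith 4 (Fintype.card V) D.edgeFinset.card 2 (by omega) hm)) v
  rw [hmdef, hcardV, Nat.add_sub_cancel] at hm
  -- the non-neighbours `R`, `|R| = 3`
  obtain ⟨R, hR⟩ : ∃ R : Finset V, R = (insert x N)ᶜ := ⟨_, rfl⟩
  have hRcard : R.card = 3 := by
    rw [hR, card_compl, card_insert_of_notMem hxN]
    omega
  have hmemR : ∀ w, w ∈ R ↔ w ≠ x ∧ ¬ D.Adj x w := by
    intro w
    rw [hR, mem_compl, mem_insert, hmemN]
    tauto
  -- the matching inside `N`
  obtain ⟨M, hM⟩ : ∃ M, adjPairs D N = 2 * M := ⟨_, adjPairs_eq_two_mul D N⟩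
  have hTf : ∑ y ∈ N, degIn D N y = 2 * M := by rw [← adjPairs_eq_sum_degIn, hM]
  -- `P = Σ_{u ∈ R} degIn N u`, `E = adjPairs R`
  obtain ⟨P, hPdef⟩ : ∃ P, ∑ u ∈ R, degIn D N u = P := ⟨_, rfl⟩
  obtain ⟨E, hEdef⟩ : ∃ E, adjPairs D R = E := ⟨_, rfl⟩
  -- the degree sum over `{x} ∪ N ∪ R`
  have hsplit : ∀ F : V → ℕ, ∑ w, F w = F x + ∑ y ∈ N, F y + ∑ u ∈ R, F u := by
    intro F
    rw [← sum_add_sum_compl (insert x N), sum_insert hxN, ← hR]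
  have hdegN : ∀ y ∈ N, deg D y = 1 + degIn D N y + degIn D R y := by
    intro y hy
    have := deg_eq_of_mem_nbhd D x y ((hmemN y).mp hy)
    rw [← hN, ← hR] at this
    exact this
  have hsumN : ∑ y ∈ N, deg D y = K + 2 * M + P := by
    rw [sum_congr rfl hdegN, sum_add_distrib, sum_add_distrib, sum_const, smul_eq_mul, mul_one, hKdef, hTf,
      sum_degIn_comm D N R, hPdef]
  have hdegR : ∀ u ∈ R, deg D u = degIn D N u + degIn D R u := by
    intro u hu
    have := deg_eq_of_not_mem_nbhd D x u ((hmemR u).mp hu).2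
    rw [← hN, ← hR] at this
    exact this
  have hsumR : ∑ u ∈ R, deg D u = P + E := by
    rw [sum_congr rfl hdegR, sum_add_distrib, hPdef, ← adjPairs_eq_sum_degIn, hEdef]
  have hdegsum := sum_deg_eq D
  rw [hsplit, hsumN, hsumR, hdx, hKdef, hmdef] at hdegsum
  -- (2) every vertex of `R` has at most `K − M` neighbours in `N` (one end of each matching edge)
  have hPle : ∀ u ∈ R, degIn D N u + M ≤ K := by
    intro u hu
    have := two_mul_degIn_add_adjPairs_le D hK (x := x) ((hmemR u).mp hu).1
    rw [← hN, hM, hKdef] at this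
    omega
  have h2 : P + 3 * M ≤ 3 * K := by
    have hs : ∑ u ∈ R, (degIn D N u + M) ≤ ∑ _u ∈ R, K := sum_le_sum hPle
    rw [sum_add_distrib, sum_const, sum_const, smul_eq_mul, smul_eq_mul, hPdef, hRcard] at hs
    exact hs
  -- (3) `E ≤ 6`
  have hE6 : E ≤ 6 := by
    have := adjPairs_le_card_mul_pred D R
    rw [hEdef, hRcard] at this
    exact this
  -- (4) an edge inside `R` forces `P + M ≤ 2K + 1`
  have hnoedge : 1 ≤ E → P + M ≤ 2 * K + 1 := by
    intro hE
    obtain ⟨u, hu, hu1⟩ : ∃ u ∈ R, 1 ≤ degIn D R u := by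
      by_contra hcon
      push Not at hcon
      have h0 : ∑ u ∈ R, degIn D R u = 0 := sum_eq_zero (fun u hu => by have := hcon u hu; omega)
      rw [← adjPairs_eq_sum_degIn, hEdef] at h0
      omega
    obtain ⟨v, hv, huv⟩ : ∃ v ∈ R, D.Adj u v := by
      unfold degIn at hu1
      obtain ⟨v, hv⟩ := card_pos.mp hu1
      rw [mem_filter] at hv
      exact ⟨v, hv.1, hv.2⟩
    have hne : u ≠ v := D.ne_of_adj huv
    have hPuv : degIn D N u + degIn D N v ≤ K + 1 := by
      have := degIn_add_degIn_le_of_adj_pair D hK N huv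
      rw [hKdef] at this
      exact this
    have hvR' : v ∈ R.erase u := mem_erase.mpr ⟨hne.symm, hv⟩
    have hsum1 := add_sum_erase R (fun w => degIn D N w) hu
    have hsum2 := add_sum_erase (R.erase u) (fun w => degIn D N w) hvR'
    have hcard2 : ((R.erase u).erase v).card = 1 := by
      rw [card_erase_of_mem hvR', card_erase_of_mem hu]
      omega
    have hrest : ∑ w ∈ (R.erase u).erase v, degIn D N w + M ≤ K := by
      have hs : ∑ w ∈ (R.erase u).erase v, (degIn D N w + M) ≤ ∑ _w ∈ (R.erase u).erase v, K :=
        sum_le_sum (fun w hw => hPle w (mem_of_mem_erase (mem_of_mem_erase hw)))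
      rw [sum_add_distrib, sum_const, sum_const, smul_eq_mul, smul_eq_mul, hcard2, one_mul, one_mul] at hs
      exact hs
    rw [hPdef] at hsum1
    omega
  -- (5) `E = 0`, `M ≤ 1`
  obtain ⟨hE0, hM1⟩ := four_cap_count K M P E m hdegsum hm h2 hE6 (by omega) hnoedge
  -- no edge inside `R`
  have hnoR : ∀ u ∈ R, degIn D R u = 0 := by
    intro u hu
    have hle : degIn D R u ≤ ∑ z ∈ R, degIn D R z := single_le_sum (fun _ _ => Nat.zero_le _) hu
    rw [← adjPairs_eq_sum_degIn, hEdef, hE0] at hle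
    exact Nat.le_zero.mp hle
  rcases Nat.eq_zero_or_pos M with hM0 | hMpos
  · -- `M = 0`: no edge inside `N`, none inside `R`: `D ⊆ K(Nᶜ, N)`
    left
    have hnoN : ∀ y ∈ N, ∀ y', D.Adj y y' → y' ∉ N := by
      intro y hy y' hyy' hy'
      have h0 : degIn D N y = 0 := by
        have hle : degIn D N y ≤ ∑ z ∈ N, degIn D N z := single_le_sum (fun _ _ => Nat.zero_le _) hy
        rw [hTf, hM0, mul_zero] at hle
        exact Nat.le_zero.mp hle
      unfold degIn at h0
      rw [card_eq_zero, filter_eq_empty_iff] at h0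
      exact h0 hy' hyy'
    have hnoR' : ∀ u ∈ R, ∀ u', D.Adj u u' → u' ∉ R := by
      intro u hu u' huu' hu'
      have h0 := hnoR u hu
      unfold degIn at h0
      rw [card_eq_zero, filter_eq_empty_iff] at h0
      exact h0 hu' huu'
    refine ⟨Nᶜ, ?_, ?_⟩
    · rw [card_compl, hKdef]
      omega
    · intro p q hpq
      rw [mem_compl, mem_compl, not_not]
      constructor
      · intro hpN
        by_contra hqN
        by_cases hpx : p = x
        · subst hpx
          exact hqN ((hmemN q).mpr hpq)
        by_cases hqx : q = x
        · subst hqx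
          exact hpN ((hmemN p).mpr (D.adj_symm hpq))
        have hpR : p ∈ R := (hmemR p).mpr ⟨hpx, fun h => hpN ((hmemN p).mpr h)⟩
        have hqR : q ∈ R := (hmemR q).mpr ⟨hqx, fun h => hqN ((hmemN q).mpr h)⟩
        exact hnoR' p hpR q hpq hqR
      · intro hqN hpN
        exact hnoN p hpN q hpq hqN
  · -- `M = 1`: the one-triangle structure, `Σ d² ≤ 4K² + 10K`
    right
    have hM1' : M = 1 := by omega
    subst hM1'
    -- `Σ_R d² ≤ (K − 1) P`
    have hSR : ∑ u ∈ R, deg D u * deg D u ≤ (K - 1) * P := by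
      have h : ∀ u ∈ R, deg D u * deg D u ≤ (K - 1) * degIn D N u := by
        intro u hu
        have e : deg D u = degIn D N u := by rw [hdegR u hu, hnoR u hu, add_zero]
        have hle : degIn D N u ≤ K - 1 := by have := hPle u hu; omega
        rw [e]
        exact Nat.mul_le_mul_right _ hle
      calc ∑ u ∈ R, deg D u * deg D u ≤ ∑ u ∈ R, (K - 1) * degIn D N u := sum_le_sum h
        _ = (K - 1) * P := by rw [← mul_sum, hPdef]
    -- `Σ_N d² ≤ K + 12 + 5P`
    have hfg : ∑ y ∈ N, degIn D N y * degIn D R y ≤ 3 := by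
      have := two_mul_sum_degIn_mul_degIn_le D hK x R (fun u hu => ((hmemR u).mp hu).1)
      rw [← hN, hM, hRcard] at this
      omega
    have hSN : ∑ y ∈ N, deg D y * deg D y ≤ K + 12 + 5 * P := by
      have h : ∀ y ∈ N, deg D y * deg D y ≤
          1 + 3 * degIn D N y + 5 * degIn D R y + 2 * (degIn D N y * degIn D R y) := by
        intro y hy
        rw [hdegN y hy]
        apply cap_sq_bound
        · have h1 := degIn_nbhd_le_one D hK (x := x) (u := y) ((hmemN y).mp hy)
          rw [← hN] at h1
          exact h1
        · have := degIn_le_card D R y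
          rw [hRcard] at this
          exact this
      calc ∑ y ∈ N, deg D y * deg D y
          ≤ ∑ y ∈ N, (1 + 3 * degIn D N y + 5 * degIn D R y + 2 * (degIn D N y * degIn D R y)) := sum_le_sum h
        _ = N.card + 3 * ∑ y ∈ N, degIn D N y + 5 * ∑ y ∈ N, degIn D R y +
            2 * ∑ y ∈ N, degIn D N y * degIn D R y := by
          rw [sum_add_distrib, sum_add_distrib, sum_add_distrib, sum_const, smul_eq_mul, mul_one, mul_sum,
            mul_sum, mul_sum]
        _ ≤ K + 12 + 5 * P := by
          rw [hKdef, hTf, sum_degIn_comm D N R, hPdef]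
          omega
    rw [hsplit (fun v => deg D v * deg D v), hdx, hKdef, hmdef, hcardV]
    rw [hE0] at hdegsum
    exact four_cap_sq_arith K P _ _ m (by omega) hm (by omega) hSN hSR

end C047

end TriangleCap

end PercRepro
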